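import Literature.Analysis.PDE.FrameOperator
import Literature.Analysis.PDE.TimeSobolevSup
import Literature.Analysis.FluidPDE.EnergyToolkit
import Mathlib.Analysis.Calculus.ContDiff.Bounds
import HarnessLib

/-!
# Frame operators: locality, slab smoothness, and generic derivative bounds (topic `Analysis/PDE`)

Toolkit shared by the approximate-solution layer (`FrameOpCommutator.lean`,
`FlatUniformBounds.lean`) and the linear/quasilinear existence layers (`LinExistTools.lean`) of
the programme to prove short-time existence for quasilinear strictly parabolic systems on a
closed manifold (hypothesis `hQL` of
`Literature.Geometry.Riemannian.ricciFlow_shortTime_existence_of_quasilinear`):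

* `frameOp_congr_of_eventuallyEq`, `frameOp_zero_fun`, `frameOp_eq_zero_of_eventuallyEq_zero`
  — locality of the frame operator;
* `isSmoothSpaceTimeOn_frameOp` — slab smoothness of `(s, y) ↦ frameOp (S s y) (𝔟 s y) (𝔠 s y) (u s) y`;
* `norm_iteratedFDeriv_comp_affine_le`, `norm_iteratedFDeriv_precomp_le`,
  `norm_iteratedFDeriv_inner_apply_le`, `norm_iteratedFDeriv_sub_const_le` — generic bounds of
  iterated derivatives.

Everything is proved; no named fact and no `sorry` is introduced.

## References

* L. Hörmander, *The Analysis of Linear Partial Differential Operators III*, Springer 1985,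
  §17.1. [Hormander1985III]
-/

noncomputable section

open Set Function Filter Topology Metric InnerProductSpace
open scoped ContDiff Topology RealInnerProductSpace

namespace Literature.Analysis.PDE

open Literature.Analysis.FunctionSpaces Literature.Analysis.FluidPDE

variable {E' : Type*} [NormedAddCommGroup E'] [InnerProductSpace ℝ E'] [FiniteDimensional ℝ E']
variable {F' : Type*} [NormedAddCommGroup F'] [InnerProductSpace ℝ F']

/-! ### Locality of the frame operator -/

/-- **Locality**: the frame operator at `y` depends only on the germ of the function at `y`.
[folklore] -/
theorem frameOp_congr_of_eventuallyEq (S₀ : E' →L[ℝ] E') (𝔟₀ : (E' →L[ℝ] F') →L[ℝ] F') (𝔠₀ : F' →L[ℝ] F')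
    {u u' : E' → F'} {y : E'} (h : u =ᶠ[𝓝 y] u') :
    frameOp S₀ 𝔟₀ 𝔠₀ u y = frameOp S₀ 𝔟₀ 𝔠₀ u' y := by
  have h1 : fderiv ℝ u =ᶠ[𝓝 y] fderiv ℝ u' := h.fderiv
  have h2 : ∀ l, (fun z ↦ fderiv ℝ u z (stdOrthonormalBasis ℝ E' l)) =ᶠ[𝓝 y]
      fun z ↦ fderiv ℝ u' z (stdOrthonormalBasis ℝ E' l) := fun l ↦ h1.mono fun z hz ↦ by simp only [hz]
  rw [frameOp_apply, frameOp_apply, principalPart_apply, principalPart_apply, h1.eq_of_nhds, h.eq_of_nhds]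
  congr 2
  refine Finset.sum_congr rfl fun k _ ↦ Finset.sum_congr rfl fun l _ ↦ ?_
  rw [(h2 l).fderiv_eq]

/-- The frame operator of the zero function vanishes. [folklore] -/
theorem frameOp_zero_fun (S₀ : E' →L[ℝ] E') (𝔟₀ : (E' →L[ℝ] F') →L[ℝ] F') (𝔠₀ : F' →L[ℝ] F') (y : E') :
    frameOp S₀ 𝔟₀ 𝔠₀ (fun _ : E' ↦ (0 : F')) y = 0 := by
  simp [frameOp_apply, principalPart_apply]

/-- The frame operator of a function vanishing near `y` vanishes at `y`. [folklore] -/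
theorem frameOp_eq_zero_of_eventuallyEq_zero (S₀ : E' →L[ℝ] E') (𝔟₀ : (E' →L[ℝ] F') →L[ℝ] F') (𝔠₀ : F' →L[ℝ] F')
    {u : E' → F'} {y : E'} (h : u =ᶠ[𝓝 y] fun _ ↦ 0) : frameOp S₀ 𝔟₀ 𝔠₀ u y = 0 := by
  rw [frameOp_congr_of_eventuallyEq S₀ 𝔟₀ 𝔠₀ h, frameOp_zero_fun]


/-! ### Slab smoothness -/

section Slab

variable {T : ℝ}

/-- **Slab smoothness of the frame operator**: for slab-smooth coefficient fields and a
slab-smooth `u`, `(s, y) ↦ frameOp (S s y) (𝔟 s y) (𝔠 s y) (u s) y` is slab-smooth. [folklore] -/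
theorem isSmoothSpaceTimeOn_frameOp (hT : 0 < T) {S : ℝ → E' → (E' →L[ℝ] E')}
    {𝔟 : ℝ → E' → ((E' →L[ℝ] F') →L[ℝ] F')} {𝔠 : ℝ → E' → (F' →L[ℝ] F')}
    (hS : IsSmoothSpaceTimeOn (Icc 0 T) S) (h𝔟 : IsSmoothSpaceTimeOn (Icc 0 T) 𝔟) (h𝔠 : IsSmoothSpaceTimeOn (Icc 0 T) 𝔠)
    {u : ℝ → E' → F'} (hu : IsSmoothSpaceTimeOn (Icc 0 T) u) :
    IsSmoothSpaceTimeOn (Icc 0 T) fun s y ↦ frameOp (S s y) (𝔟 s y) (𝔠 s y) (u s) y := by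
  have hu1 : ∀ w, IsSmoothSpaceTimeOn (Icc 0 T) fun s z ↦ fderiv ℝ (u s) z w := fun w ↦
    isSmoothSpaceTimeOn_fderiv_apply_Icc hT hu w
  have hu2 : ∀ w w', IsSmoothSpaceTimeOn (Icc 0 T) fun s z ↦ fderiv ℝ (fun y ↦ fderiv ℝ (u s) y w) z w' :=
    fun w w' ↦ isSmoothSpaceTimeOn_fderiv_apply_Icc hT (hu1 w) w'
  have hP : IsSmoothSpaceTimeOn (Icc 0 T) fun s z ↦ principalPart (S s z) (u s) z := by
    have heq : (fun s z ↦ principalPart (S s z) (u s) z) = fun s z ↦ ∑ a, ∑ l,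
        ⟪stdOrthonormalBasis ℝ E' a, (S s z) (stdOrthonormalBasis ℝ E' l)⟫ •
        fderiv ℝ (fun y ↦ fderiv ℝ (u s) y (stdOrthonormalBasis ℝ E' l)) z (stdOrthonormalBasis ℝ E' a) := by
      funext s z; rw [principalPart_apply]
    rw [heq]
    unfold IsSmoothSpaceTimeOn at hS hu2 ⊢
    have hc : ∀ a l, ContDiffOn ℝ ∞ (fun q : ℝ × E' ↦ ⟪stdOrthonormalBasis ℝ E' a, (S q.1 q.2)
        (stdOrthonormalBasis ℝ E' l)⟫) (Icc 0 T ×ˢ univ) := fun a l ↦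
      contDiffOn_const.inner ℝ (hS.clm_apply contDiffOn_const)
    have : (uncurry fun s z ↦ ∑ a, ∑ l, ⟪stdOrthonormalBasis ℝ E' a, (S s z) (stdOrthonormalBasis ℝ E' l)⟫ •
        fderiv ℝ (fun y ↦ fderiv ℝ (u s) y (stdOrthonormalBasis ℝ E' l)) z (stdOrthonormalBasis ℝ E' a)) =
        fun q : ℝ × E' ↦ ∑ a, ∑ l, ⟪stdOrthonormalBasis ℝ E' a, (S q.1 q.2) (stdOrthonormalBasis ℝ E' l)⟫ •
          (uncurry fun s z ↦ fderiv ℝ (fun y ↦ fderiv ℝ (u s) y (stdOrthonormalBasis ℝ E' l)) z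
            (stdOrthonormalBasis ℝ E' a)) q := by
      funext ⟨s, z⟩; rfl
    rw [this]
    exact ContDiffOn.sum fun a _ ↦ ContDiffOn.sum fun l _ ↦ (hc a l).smul (hu2 _ _)
  have hB : IsSmoothSpaceTimeOn (Icc 0 T) fun s z ↦ 𝔟 s z (fderiv ℝ (u s) z) :=
    h𝔟.clm_apply (hu.fderiv_slice (uniqueDiffOn_Icc hT))
  have hC : IsSmoothSpaceTimeOn (Icc 0 T) fun s z ↦ 𝔠 s z (u s z) := h𝔠.clm_apply hu
  have heq : (fun s y ↦ frameOp (S s y) (𝔟 s y) (𝔠 s y) (u s) y) = fun s y ↦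
      principalPart (S s y) (u s) y + 𝔟 s y (fderiv ℝ (u s) y) + 𝔠 s y (u s y) := by
    funext s y; rw [frameOp_apply]
  rw [heq]
  exact (hP.add hB).add hC

end Slab

variable {F : Type*} [NormedAddCommGroup F] [NormedSpace ℝ F]

/-! ### Generic iterated-derivative bounds -/

section Generic

variable {X Y W : Type*} [NormedAddCommGroup X] [NormedSpace ℝ X] [NormedAddCommGroup Y] [NormedSpace ℝ Y]
  [NormedAddCommGroup W] [NormedSpace ℝ W]

omit [FiniteDimensional ℝ E'] in
/-- **Iterated derivatives under an affine map**: `‖Dᵐ(f ∘ Ψ)(z)‖ ≤ ‖B‖ᵐ ‖Dᵐ f(Ψ z)‖`,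
`Ψ z = B z + c`. [folklore] -/
theorem norm_iteratedFDeriv_comp_affine_le (B : E' →L[ℝ] E') (c : E') {f : E' → F} (hf : ContDiff ℝ ∞ f) (m : ℕ) (z : E') :
    ‖iteratedFDeriv ℝ m (fun z ↦ f (B z + c)) z‖ ≤ ‖B‖ ^ m * ‖iteratedFDeriv ℝ m f (B z + c)‖ := by
  have h1 : (fun z ↦ f (B z + c)) = (fun y ↦ f (y + c)) ∘ B := rfl
  have hfc : ContDiff ℝ ∞ fun y ↦ f (y + c) := hf.comp (contDiff_id.add contDiff_const)
  rw [h1, B.iteratedFDeriv_comp_right hfc z (i := m) (by exact_mod_cast le_top), iteratedFDeriv_comp_add_right]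
  refine (ContinuousMultilinearMap.norm_compContinuousLinearMap_le _ _).trans ?_
  rw [mul_comm]
  refine mul_le_mul_of_nonneg_right (le_of_eq ?_) (norm_nonneg _)
  simp

/-- Postcomposition with a fixed continuous linear map: `‖Dᵐ(z ↦ L ∘ G z)‖ ≤ ‖L‖ ‖Dᵐ G‖`.
[folklore] -/
theorem norm_iteratedFDeriv_postcomp_le {G : X → (W →L[ℝ] Y)} (hG : ContDiff ℝ ∞ G) {Z : Type*} [NormedAddCommGroup Z]
    [NormedSpace ℝ Z] (L : Y →L[ℝ] Z) (m : ℕ) (z : X) :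
    ‖iteratedFDeriv ℝ m (fun z ↦ L ∘L G z) z‖ ≤ ‖L‖ * ‖iteratedFDeriv ℝ m G z‖ := by
  have h1 : (fun z ↦ L ∘L G z) = ((ContinuousLinearMap.compL ℝ W Y Z) L) ∘ G := rfl
  have hΦ : ‖(ContinuousLinearMap.compL ℝ W Y Z) L‖ ≤ ‖L‖ :=
    ContinuousLinearMap.opNorm_le_bound _ (norm_nonneg _) fun P ↦ by
      simpa using ContinuousLinearMap.opNorm_comp_le L P
  rw [h1]
  exact (ContinuousLinearMap.norm_iteratedFDeriv_comp_left _ hG.contDiffAt (n := m) (by exact_mod_cast le_top)).trans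
    (mul_le_mul_of_nonneg_right hΦ (norm_nonneg _))

/-- Precomposition with a fixed continuous linear map: `‖Dᵐ(z ↦ G z ∘ K)‖ ≤ ‖K‖ ‖Dᵐ G‖`.
[folklore] -/
theorem norm_iteratedFDeriv_precomp_le {G : X → (W →L[ℝ] Y)} (hG : ContDiff ℝ ∞ G) {V : Type*} [NormedAddCommGroup V]
    [NormedSpace ℝ V] (K : V →L[ℝ] W) (m : ℕ) (z : X) :
    ‖iteratedFDeriv ℝ m (fun z ↦ G z ∘L K) z‖ ≤ ‖K‖ * ‖iteratedFDeriv ℝ m G z‖ := by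
  have h1 : (fun z ↦ G z ∘L K) = ((ContinuousLinearMap.compL ℝ V W Y).flip K) ∘ G := by
    funext z; simp
  have hΦ : ‖(ContinuousLinearMap.compL ℝ V W Y).flip K‖ ≤ ‖K‖ :=
    ContinuousLinearMap.opNorm_le_bound _ (norm_nonneg _) fun P ↦ by
      rw [mul_comm]
      simpa using ContinuousLinearMap.opNorm_comp_le P K
  rw [h1]
  exact (ContinuousLinearMap.norm_iteratedFDeriv_comp_left _ hG.contDiffAt (n := m) (by exact_mod_cast le_top)).trans
    (mul_le_mul_of_nonneg_right hΦ (norm_nonneg _))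

omit [FiniteDimensional ℝ E'] in
/-- A matrix entry of an operator field: `‖Dᵐ(z ↦ ⟪v, G z w⟫)‖ ≤ ‖v‖ ‖w‖ ‖Dᵐ G‖`. [folklore] -/
theorem norm_iteratedFDeriv_inner_apply_le {G : X → (E' →L[ℝ] E')} (hG : ContDiff ℝ ∞ G) (v w : E') (m : ℕ) (z : X) :
    ‖iteratedFDeriv ℝ m (fun z ↦ ⟪v, G z w⟫) z‖ ≤ ‖v‖ * ‖w‖ * ‖iteratedFDeriv ℝ m G z‖ := by
  have h1 : (fun z ↦ ⟪v, G z w⟫) = (innerSL ℝ v) ∘ fun z ↦ G z w := rfl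
  have hGw : ContDiff ℝ ∞ fun z ↦ G z w := hG.clm_apply contDiff_const
  rw [h1]
  refine (ContinuousLinearMap.norm_iteratedFDeriv_comp_left _ hGw.contDiffAt (n := m) (by exact_mod_cast le_top)).trans ?_
  rw [innerSL_apply_norm, mul_assoc]
  refine mul_le_mul_of_nonneg_left ?_ (norm_nonneg _)
  exact norm_iteratedFDeriv_clm_apply_const hG.contDiffAt (by exact_mod_cast le_top)

omit [FiniteDimensional ℝ E'] in
/-- Subtracting a constant does not change the derivatives of positive order; at order zero it
costs the norm of the constant. [folklore] -/
theorem norm_iteratedFDeriv_sub_const_le {G : E' → F} (hG : ContDiff ℝ ∞ G) (c : F) (m : ℕ) (z : E') :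
    ‖iteratedFDeriv ℝ m (fun z ↦ G z - c) z‖ ≤ ‖iteratedFDeriv ℝ m G z‖ + ‖c‖ := by
  rcases Nat.eq_zero_or_pos m with rfl | hm
  · simp only [norm_iteratedFDeriv_zero]
    exact norm_sub_le _ _
  · have h : iteratedFDeriv ℝ m (fun z ↦ G z - c) z = iteratedFDeriv ℝ m G z := by
      have h1 : (fun z ↦ G z - c) = G + fun _ ↦ -c := by funext z; simp [sub_eq_add_neg]
      rw [h1, iteratedFDeriv_add_apply (hG.contDiffAt.of_le (by exact_mod_cast le_top))
        (contDiff_const.contDiffAt.of_le (by exact_mod_cast le_top)), iteratedFDeriv_const_of_ne hm.ne' (-c)]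
      simp
    rw [h]
    exact le_add_of_nonneg_right (norm_nonneg _)

end Generic

end Literature.Analysis.PDE
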